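import Summits.NavierStokesRegularity.FluidComputer.DesignedBlowupSerrinDivergenceOfF2
import HarnessLib

/-!
# No sub-Leray rate in any `L^r`, `3 < r ≤ ∞`, for a designed forced blow-up — modulo F2

Cell `ns-blowup`, seat `ns-blowup-ecbridge-2` (g4; the E–C endpoint theory seat). LABEL: E–C typing
(KERNEL modulo ONE named fact, F2 = `tao2011_smooth_local_existence_forced`). WHAT THIS IS NOT: not
Navier–Stokes evidence — a necessary condition on the TYPE `DesignedBlowup`. Companion memo:
`run/shared/lean/pub/ns-blowup/ecbridge2/ECBRIDGE-2-MEMO-3.md` §2 (rows R2/R5).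

## Content

Leray's rate (LR16 Thm. 11.4, the tree FACT `lemarieRieusset2016_lerayRate_forced`) says
`‖u(t)‖_{L^q} ≳ (T−t)^{−(1−3/q)/2}`. Its weak form — NO rate `‖u(t)‖_{L^r} ≤ C (T−t)^{−γ}` with
`γ < (1 − 3/r)/2` — is a consequence of the Serrin divergence `∫₀ᵀ ‖u‖_{L^r}^{2/(1−3/r)} = ∞` (the
comparison integral `∫₀ᵀ (T−t)^{−2γ/(1−3/r)} dt` converges iff `2γ/(1−3/r) < 1`), hence, for the
generic E–C object, a THEOREM modulo F2 (`DesignedBlowupSerrinDivergenceOfF2.lean`):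

* `lintegral_ofReal_rate_rpow_lt_top` — `∫₀ᵀ (C (T−t)^{−γ})^e dt < ∞` for `C ≥ 0`, `e ≥ 0`, `γ e < 1`;
* **`DesignedBlowup.not_subLerayRate_of_F2'`** — (`(u, p')` classical with a Tao-class pressure `p'`,
  `∂ₜu` class as hypothesis; `u`'s class fact-free) GIVEN F2: for `3 < r ≤ ∞` and
  `γ < (1 − (3/r).toReal)/2` there is no bound `‖u(t)‖_{L^r} ≤ C (T−t)^{−γ}` on `(0, T)`;
* **`DesignedBlowup.not_subLerayRate_of_F2`** — the same for a design with Tao-normalised pressure,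
  no further hypothesis. The `r = ∞` member (`γ < 1/2`) is `not_subTypeI_of_F2`.

References: J. Leray, Acta Math. 63 (1934), (3.16) [cite: Leray1934, (3.16)]; P. G. Lemarié-Rieusset
(2016), Thm. 11.2, Thm. 11.4 [cite: LemarieRieusset2016, Thm. 11.4]; T. Tao, Anal. PDE 6 (2013),
Thm. 5.4 [cite: Tao2011, Thm. 5.4].
-/

noncomputable section

namespace Summit.NavierStokesRegularity.FluidComputer

namespace DesignedBlowup

open Set MeasureTheory Filter Topology Function
open scoped ENNReal NNReal
open Literature.Analysis.FluidPDE

/-- **The comparison integral of a rate converges**: for `T > 0`, `C ≥ 0` and `γ e < 1`,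
`∫₀ᵀ (C (T − t)^{−γ})^e dt < ∞` (power `(T−t)^{−γe}` with `−γe > −1`). [folklore] -/
theorem lintegral_ofReal_rate_rpow_lt_top {T C γ e : ℝ} (hT : 0 < T) (hC : 0 ≤ C)
    (hγe : γ * e < 1) :
    ∫⁻ t in Ioo 0 T, ENNReal.ofReal ((C * (T - t) ^ (-γ)) ^ e) < ⊤ := by
  have hint : IntervalIntegrable (fun t : ℝ => (T - t) ^ (-(γ * e))) volume 0 T := by
    have h := (intervalIntegral.intervalIntegrable_rpow' (a := T) (b := 0) (r := -(γ * e))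
      (by linarith)).comp_sub_left T
    simpa using h
  have hIntOn : IntegrableOn (fun t : ℝ => C ^ e * (T - t) ^ (-(γ * e))) (Ioo 0 T) volume := by
    have h1 := ((intervalIntegrable_iff_integrableOn_Ioc_of_le hT.le).1 hint).mono_set
      Ioo_subset_Ioc_self
    exact h1.const_mul _
  have hfin : ∫⁻ t in Ioo 0 T, ENNReal.ofReal (C ^ e * (T - t) ^ (-(γ * e))) < ⊤ :=
    lt_of_le_of_lt (lintegral_ofReal_le_lintegral_enorm _) hIntOn.2
  refine lt_of_le_of_lt (setLIntegral_mono' measurableSet_Ioo fun t ht => ENNReal.ofReal_le_ofReal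
    (le_of_eq ?_)) hfin
  have hTt : 0 < T - t := by linarith [ht.2]
  rw [Real.mul_rpow hC (Real.rpow_nonneg hTt.le _), ← Real.rpow_mul hTt.le]
  congr 2
  ring

variable {ν : ℝ} (D : DesignedBlowup ν)

/-- The Serrin time exponent `2/(1 − (3/r).toReal)` is `2/θ` with `0 < θ ≤ 1` for `3 < r ≤ ∞`. [folklore] -/
theorem serrinExponent_pos {r : ℝ≥0∞} (hr : 3 < r) : 0 < 1 - (3 / r).toReal := by
  rcases eq_or_ne r ⊤ with h | h
  · simp [h]
  · have hr' : (3 : ℝ) < r.toReal := by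
      have := (ENNReal.toReal_lt_toReal (by simp) h).2 hr
      simpa using this
    rw [ENNReal.toReal_div]
    have h3 : ((3 : ℝ≥0∞)).toReal = 3 := by simp
    rw [h3, sub_pos, div_lt_one (by linarith)]
    exact hr'

/-- **No sub-Leray rate in `L^r` (arbitrary Tao-class pressure), GIVEN F2.** For `D : DesignedBlowup ν`,
`ν > 0`, `(u, p')` classical with `∂ₜu` and `p'` in Tao's class on closed sub-slabs, `3 < r ≤ ∞`,
`C ≥ 0` and `γ < (1 − (3/r).toReal)/2`: the bound `‖u(t)‖_{L^r} ≤ C (T−t)^{−γ}` on `(0, T)` is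
impossible (its Serrin integral would converge). Leray's exponent `(1 − 3/r)/2` is the borderline.
[cite: Leray1934, (3.16)] [cite: LemarieRieusset2016, Thm. 11.4] [cite: Tao2011, Thm. 5.4] -/
theorem not_subLerayRate_of_F2' (hF : tao2011_smooth_local_existence_forced) (hν : 0 < ν)
    {p' : ℝ → EuclideanSpace ℝ (Fin 3) → ℝ}
    (hsol : IsClassicalNSSolutionOn (Ico 0 D.T) ν D.f D.u p')
    (hut : ∀ T' ∈ Ioo 0 D.T, HasBoundedSobolevNormsOn (Icc 0 T') (timeDerivWithin (Icc 0 T') D.u))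
    (hp : ∀ T' ∈ Ioo 0 D.T, ∀ n : ℕ, ∃ C : ℝ≥0, ∀ t ∈ Icc 0 T',
      ∫⁻ x, ‖iteratedFDeriv ℝ n (p' t) x‖ₑ ^ 2 ≤ C)
    {r : ℝ≥0∞} (hr : 3 < r) {C γ : ℝ} (hC : 0 ≤ C) (hγ : γ < (1 - (3 / r).toReal) / 2)
    (hrate : ∀ t ∈ Ioo 0 D.T, eLpNorm (D.u t) r volume ≤ ENNReal.ofReal (C * (D.T - t) ^ (-γ))) :
    False := by
  have htop := D.lintegral_serrin_eq_top_of_F2' hF hν hsol hut hp hr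
  set θ : ℝ := 1 - (3 / r).toReal with hθ
  have hθ0 : 0 < θ := serrinExponent_pos hr
  set e : ℝ := 2 / θ with he
  have he0 : 0 ≤ e := by positivity
  have hγe : γ * e < 1 := by
    rw [he, mul_div_assoc', div_lt_one hθ0]
    linarith
  have hfin := lintegral_ofReal_rate_rpow_lt_top (γ := γ) D.T_pos hC hγe
  have hle : ∫⁻ t in Ioo 0 D.T, ENNReal.ofReal ((eLpNorm (D.u t) r volume).toReal ^ e) ≤
      ∫⁻ t in Ioo 0 D.T, ENNReal.ofReal ((C * (D.T - t) ^ (-γ)) ^ e) := by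
    refine setLIntegral_mono' measurableSet_Ioo fun t ht => ENNReal.ofReal_le_ofReal ?_
    have hTt : 0 < D.T - t := by linarith [ht.2]
    have hM0 : 0 ≤ C * (D.T - t) ^ (-γ) := mul_nonneg hC (Real.rpow_nonneg hTt.le _)
    have hN : (eLpNorm (D.u t) r volume).toReal ≤ C * (D.T - t) ^ (-γ) :=
      ENNReal.toReal_le_of_le_ofReal hM0 (hrate t ht)
    exact Real.rpow_le_rpow ENNReal.toReal_nonneg hN he0
  exact absurd (htop ▸ hle) (not_le.2 hfin)

/-- **No sub-Leray rate in `L^r` for a design with Tao-normalised pressure, GIVEN F2 only.**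
[cite: Leray1934, (3.16)] [cite: LemarieRieusset2016, Thm. 11.4] [cite: Tao2011, Thm. 5.4] -/
theorem not_subLerayRate_of_F2 (hF : tao2011_smooth_local_existence_forced) (hν : 0 < ν)
    (hnorm : HasForcedNormalisedPressure D.u D.f D.p (Ico 0 D.T))
    {r : ℝ≥0∞} (hr : 3 < r) {C γ : ℝ} (hC : 0 ≤ C) (hγ : γ < (1 - (3 / r).toReal) / 2)
    (hrate : ∀ t ∈ Ioo 0 D.T, eLpNorm (D.u t) r volume ≤ ENNReal.ofReal (C * (D.T - t) ^ (-γ))) :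
    False := by
  have htop := D.lintegral_serrin_eq_top_of_F2 hF hν hnorm hr
  set θ : ℝ := 1 - (3 / r).toReal with hθ
  have hθ0 : 0 < θ := serrinExponent_pos hr
  set e : ℝ := 2 / θ with he
  have he0 : 0 ≤ e := by positivity
  have hγe : γ * e < 1 := by
    rw [he, mul_div_assoc', div_lt_one hθ0]
    linarith
  have hfin := lintegral_ofReal_rate_rpow_lt_top (γ := γ) D.T_pos hC hγe
  have hle : ∫⁻ t in Ioo 0 D.T, ENNReal.ofReal ((eLpNorm (D.u t) r volume).toReal ^ e) ≤
      ∫⁻ t in Ioo 0 D.T, ENNReal.ofReal ((C * (D.T - t) ^ (-γ)) ^ e) := by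
    refine setLIntegral_mono' measurableSet_Ioo fun t ht => ENNReal.ofReal_le_ofReal ?_
    have hTt : 0 < D.T - t := by linarith [ht.2]
    have hM0 : 0 ≤ C * (D.T - t) ^ (-γ) := mul_nonneg hC (Real.rpow_nonneg hTt.le _)
    have hN : (eLpNorm (D.u t) r volume).toReal ≤ C * (D.T - t) ^ (-γ) :=
      ENNReal.toReal_le_of_le_ofReal hM0 (hrate t ht)
    exact Real.rpow_le_rpow ENNReal.toReal_nonneg hN he0
  exact absurd (htop ▸ hle) (not_le.2 hfin)

end DesignedBlowup

end Summit.NavierStokesRegularity.FluidComputer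

end
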